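import Summits.HodgeConjecture.HodgeConjecture.Theorems.K2E1bGKCohomologyU21Defs
import Literature.NumberTheory.Automorphic.UpqComplexifiedAction
import HarnessLib

/-!
# K2 ∕ E1b — DEFS LEAF D-U8-1 «the cubic Gelfand invariant of `𝔤𝔩₃` and the cubic pin of a `(𝔲(2,1), K)`-class»

Cell hodgecm-mathlib, Track B «K2-LIT», engine E1b, unit U8 «archimedean packet signs»; crux item h413 = stmt-HodgeConjecture-24833;
author K2E1b-plan (g3).  DEFS-BEFORE-SIGS (K2-lead RULING R3 (d)): the LEVEL-B′ sockets of the workfile's TABLE ED. 7 §2c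
(`Cruxes/H413/Lines/K2_E1b_GKCohomologyU21_U8_ArchPacketSigns.md`) — U8-8a «Clozel–Delorme pseudo-coefficient with χ-support» and
U8-8b «unitary dual of `U(2,1)` at a regular integral infinitesimal character» — name ONE notion the tree lacks: the scalar by which the
DEGREE-THREE generator of the centre `Z(𝔤𝔩₃)` acts on an irreducible `(𝔤, K)`-module.  (The χ-currency of ★ `HasChiScalars` records only the
degree-1 and degree-2 generators `(e, κ)`; these do NOT determine the infinitesimal character: the regular integral parameters `(5,1,−6)` and
`(6,−1,−5)` share `(κ, e) = (60, 0)`.)  THIS FILE is that leaf.  Definitions with bodies + `Iff.rfl` unfoldings + three integer identities;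
no `sorry`, no axiom, no new instance (one `attribute [local instance] LieRing.ofAssociativeRing`, the Mathlib idiom of every ★ `Upq*` ∕ E1b file),
no notation.

THE MATHEMATICS.  For `(𝔤, K)`-module data `ρ𝔤 : 𝔲(α,β) →ₗ⁅ℝ⁆ End_ℂ V` write `ρ_ℂ := upqLieC ρ𝔤 : 𝔤𝔩(α ⊕ β, ℂ) →ₗ⁅ℂ⁆ End_ℂ V` for the
complexified action (★ `UpqComplexifiedAction`) and `E_{ij} := ρ_ℂ(Matrix.single i j 1)`.  The CUBIC GELFAND ELEMENT is
`C₃ := Σ_{i,j,k} E_{ij} E_{jk} E_{ki}` (composition order as written: `E_{ki}` acts first) — `upqCubicOp`.  It is central in `U(𝔤𝔩_n)`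
([Molev2007, §7.1]; [Iachello2015, §7.1–7.4]) and, on a module on which the centre acts through the Harish-Chandra parameter
`λ = (λ₁, λ₂, λ₃)` (`ρ = (1, 0, −1)`; highest weight `λ − ρ` when there is one), it acts by the PERELOMOV–POPOV value
`c₃(λ) = Σᵢ ℓᵢ³ ∏_{j ≠ i} (1 − (ℓᵢ − ℓⱼ)⁻¹)`, `ℓᵢ = λᵢ + 1` (Perelomov–Popov 1966; [Iachello2015, (7.20)–(7.24)]; [Molev2007, Thm. 7.1.1]), which for `n = 3` is the symmetric integer polynomial
`cubicOf λ₁ λ₂ λ₃ = p₃ + (3p₂ − p₁²)∕2 − 2p₁ − 3` (`p_k` the power sums) — CALIBRATION TARGETS proved here as integer identities: the trivial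
representation (`λ = ρ`) `↦ 0`, `det^m` (`λ = (m+1, m, m−1)`, every `E_{ij}` acts by `m δ_{ij}`) `↦ 3m³`, the standard representation `ℂ³`
(`λ = (2, 0, −1)`, `C₃ = 9·1` as a matrix identity) `↦ 9`.  In the same currency the tree's ★ `casimirOf λ = p₂ − 2` and ★ `centralOf λ = p₁`
are the degree-2 and degree-1 values (`Σᵢ ℓᵢ² ∏(…) = p₂ − 2`, `Σᵢ ℓᵢ ∏(…) = p₁`), and `(p₁, p₂, p₃)` determine the multiset `{λ₁, λ₂, λ₃}`
(Newton), i.e. the infinitesimal character.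

CONVENTION GUARD (why the sockets use the RELATIVE pin).  `cubicOf` is the print's closed form; whether the tree's realisation of the
discrete-series cells (★ `K2E1bDSCellData.dsCellDatum`, Kovačević's arrows) matches it on the nose — rather than, say, its image under an outer
automorphism of `𝔤𝔩₃` — is a COMPUTATION to be landed as a LAWS theorem (`HasCubicPin (dsClsOfRecord a b c j) (cubicOf a b c)`, row U8-4c of
the table) BEFORE any socket may name `cubicOf`.  Until then the sockets pin a class RELATIVE to the record cell
(`∃ s, HasCubicPin x s ∧ HasCubicPin (dsClsOfRecord a b c 0) s`), which needs no closed form.  `HasCubicPin` asks for SOME representative, like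
★ `IsChiPinnedCohUnitary`; invariance under `(𝔤,K)`-isomorphism is the routine transport of ★ `upqLieC` along an intertwiner (to be filed with
the LAWS, not needed by the sockets, which only ever COMPARE pins supplied by hypotheses).

Sources: [Iachello2015] F. Iachello, *Lie Algebras and Applications*, 2nd ed., LNP 891 (2015), §7.4.1 (7.20)–(7.24) (the Perelomov–Popov
algorithm and the order `≤ 3` eigenvalues for `u(n)`; original: A. M. Perelomov, V. S. Popov, Soviet J. Nuclear Phys. 3 (1966) 676–680);
[Molev2007] A. Molev, *Yangians and Classical Lie Algebras*, AMS Surveys 143 (2007), §7.1 (Gelfand invariants; centrality; Thm. 7.1.1);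
[KnappVogan1995] Prop. 4.120 (infinitesimal character vs. highest weight `+ ρ`); the consumers: [ClozelDelorme1990] Prop. 4 + Corollaire
(pp. 213–214) and Wallach, arXiv:1106.1127, Lemma 5.23 (a pseudo-coefficient's trace is supported on ONE infinitesimal character).
AUDIT (materialised pages, corpus key `book:iachello2015-lie-algebras-applications`): p0093.txt (7.4) `C_p = E_{i₁i₂} E_{i₂i₃} ⋯ E_{i_p i₁}`
(summation convention; our composition order); p0094.txt (7.20) `S_k = Σᵢ (ℓᵢ^k − ρᵢ^k)`, `ρᵢ = n − i`,
`ℓᵢ = mᵢ + n − i`; (7.24) `⟨C₁⟩ = S₁`, `⟨C₂⟩ = S₂ − (n−1)S₁`, `⟨C₃⟩ = S₃ − (n − 3∕2)S₂ − ½S₁² − (n−1)S₁`; at `n = 3`, `m = λ − (1,0,−1)`: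
`⟨C₁⟩ = p₁` (★ `centralOf`), `⟨C₂⟩ = p₂ − 2` (★ `casimirOf`), `⟨C₃⟩ = p₃ + (3∕2)p₂ − ½p₁² − 2p₁ − 3` (`cubicOf`, `two_mul_cubicOf`).

HONEST LABEL: HC_CM is proved only modulo the 7 printed citations (2 remaining named inputs: hLiu418 = stmt-HodgeConjecture-24832,
h413 = stmt-HodgeConjecture-24833) until rung 0 closes; this file asserts nothing about them (definitions and integer identities only).
-/

set_option autoImplicit false
set_option linter.dupNamespace false

noncomputable section

namespace Summit.HodgeConjecture.HodgeConjecture.Cruxes.H413.K2E1bGKCohomologyU21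

open Literature.NumberTheory.Automorphic
open Literature.RepresentationTheory
open Literature.RepresentationTheory.BorelWallach2000
open Literature.RepresentationTheory.KonnoKonno2007 Literature.RepresentationTheory.KonnoKonno2007.RealDualPair
open Literature.RepresentationTheory.KonnoKonno2007.RealDualPair.UForm

-- Mathlib idiom (as in `GKModules`, `GKCohomology`, the `Upq*` files): commutator bracket on `Module.End`
attribute [local instance 100] LieRing.ofAssociativeRing

/-! ## §1 The cubic Gelfand element through the complexified action -/

section General

variable {α β : Type} [Fintype α] [DecidableEq α] [Fintype β] [DecidableEq β]
variable {V : Type*} [AddCommGroup V] [Module ℂ V] (ρ𝔤 : (uFormGroup α β).lie →ₗ⁅ℝ⁆ Module.End ℂ V)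

/-- **The cubic Gelfand element `C₃ = Σ_{i,j,k} E_{ij} E_{jk} E_{ki}`** of `U(𝔤𝔩(α ⊕ β, ℂ))` acting on `V` through the complexified action
`ρ_ℂ = upqLieC ρ𝔤` (`E_{ij} = ρ_ℂ(Matrix.single i j 1)`; composition order as written). [cite: Molev2007, §7.1] [cite: Iachello2015, (7.4)] -/
def upqCubicOp : Module.End ℂ V :=
  ∑ i : α ⊕ β, ∑ j : α ⊕ β, ∑ k : α ⊕ β,
    upqLieC ρ𝔤 (Matrix.single i j (1 : ℂ)) * upqLieC ρ𝔤 (Matrix.single j k (1 : ℂ)) * upqLieC ρ𝔤 (Matrix.single k i (1 : ℂ))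

/-- Unfolding of `upqCubicOp`. [cite: Molev2007, §7.1] -/
theorem upqCubicOp_eq :
    upqCubicOp ρ𝔤 = ∑ i : α ⊕ β, ∑ j : α ⊕ β, ∑ k : α ⊕ β,
      upqLieC ρ𝔤 (Matrix.single i j (1 : ℂ)) * upqLieC ρ𝔤 (Matrix.single j k (1 : ℂ)) * upqLieC ρ𝔤 (Matrix.single k i (1 : ℂ)) :=
  rfl

/-- Pointwise unfolding of `upqCubicOp`. [cite: Molev2007, §7.1] -/
theorem upqCubicOp_apply (v : V) :
    upqCubicOp ρ𝔤 v = ∑ i : α ⊕ β, ∑ j : α ⊕ β, ∑ k : α ⊕ β,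
      upqLieC ρ𝔤 (Matrix.single i j (1 : ℂ)) (upqLieC ρ𝔤 (Matrix.single j k (1 : ℂ)) (upqLieC ρ𝔤 (Matrix.single k i (1 : ℂ)) v)) := by
  simp only [upqCubicOp, LinearMap.sum_apply, Module.End.mul_apply]

/-- **`C₃` acts by the scalar `s`** on the module `(V, ρ𝔤)`. [cite: Molev2007, §7.1] -/
def HasCubicScalar (s : ℂ) : Prop :=
  ∀ v : V, upqCubicOp ρ𝔤 v = s • v

/-- Unfolding of `HasCubicScalar`. [cite: Molev2007, §7.1] -/
theorem hasCubicScalar_iff (s : ℂ) : HasCubicScalar ρ𝔤 s ↔ ∀ v : V, upqCubicOp ρ𝔤 v = s • v :=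
  Iff.rfl

/-- A cubic scalar is unique on a nonzero module. [folklore] -/
theorem HasCubicScalar.unique {s t : ℂ} (hs : HasCubicScalar ρ𝔤 s) (ht : HasCubicScalar ρ𝔤 t) {v : V} (hv : v ≠ 0) : s = t := by
  have h : s • v = t • v := by rw [← hs v, ← ht v]
  exact smul_left_injective ℂ hv h

end General

/-! ## §2 The cubic pin of a `(𝔲(2,1), K)`-class and the closed form -/

/-- **A class with cubic pin `s`**: SOME representative irreducible admissible `(𝔲(2,1), K)`-module has `C₃ = s·1` (same shape as
★ `IsChiPinnedCohUnitary`, which pins the degree-1 and degree-2 generators).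
— a route-posited statement of the engine line, not a result of the literature (hence untagged). -/
def HasCubicPin (x : GKIrrClass (uFormGroup (Fin 2) (Fin 1))) (s : ℂ) : Prop :=
  ∃ r : GKIrrep (uFormGroup (Fin 2) (Fin 1)), GKIrrClass.mk r = x ∧ HasCubicScalar r.ρ𝔤 s

/-- Unfolding of `HasCubicPin`. [folklore] -/
theorem hasCubicPin_iff (x : GKIrrClass (uFormGroup (Fin 2) (Fin 1))) (s : ℂ) :
    HasCubicPin x s ↔ ∃ r : GKIrrep (uFormGroup (Fin 2) (Fin 1)), GKIrrClass.mk r = x ∧ HasCubicScalar r.ρ𝔤 s :=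
  Iff.rfl

/-- A representative with cubic scalar `s` pins its class. [folklore] -/
theorem hasCubicPin_mk (r : GKIrrep (uFormGroup (Fin 2) (Fin 1))) {s : ℂ} (h : HasCubicScalar r.ρ𝔤 s) :
    HasCubicPin (GKIrrClass.mk r) s :=
  ⟨r, rfl, h⟩

/-- **Same cubic pin**: the classes `x` and `y` carry a common cubic scalar — the RELATIVE pin the LEVEL-B′ sockets use (no closed form needed).
— a route-posited statement of the engine line, not a result of the literature (hence untagged). -/
def SameCubicPin (x y : GKIrrClass (uFormGroup (Fin 2) (Fin 1))) : Prop :=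
  ∃ s : ℂ, HasCubicPin x s ∧ HasCubicPin y s

/-- Unfolding of `SameCubicPin`. [folklore] -/
theorem sameCubicPin_iff (x y : GKIrrClass (uFormGroup (Fin 2) (Fin 1))) :
    SameCubicPin x y ↔ ∃ s : ℂ, HasCubicPin x s ∧ HasCubicPin y s :=
  Iff.rfl

/-- `SameCubicPin` is symmetric. [folklore] -/
theorem SameCubicPin.symm {x y : GKIrrClass (uFormGroup (Fin 2) (Fin 1))} (h : SameCubicPin x y) : SameCubicPin y x := by
  obtain ⟨s, hx, hy⟩ := h
  exact ⟨s, hy, hx⟩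

/-- **Perelomov–Popov closed form** of the `C₃`-scalar at Harish-Chandra parameter `(a, b, c)` (`ρ = (1,0,−1)`):
`p₃ + (3p₂ − p₁²)∕2 − 2p₁ − 3` written without division (`3p₂ − p₁² = 2(a²+b²+c²−ab−bc−ca)`).  CONVENTION GUARD: not to be named by a socket
before the LAWS calibration `HasCubicPin (dsClsOfRecord a b c j) (cubicOf a b c)` lands (module docstring). [cite: Iachello2015, (7.24)]
[cite: Molev2007, Thm. 7.1.1] -/
def cubicOf (a b c : ℤ) : ℤ :=
  a ^ 3 + b ^ 3 + c ^ 3 + (a ^ 2 + b ^ 2 + c ^ 2 - a * b - b * c - c * a) - 2 * (a + b + c) - 3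

/-- `cubicOf` is the Perelomov–Popov value in power-sum form: `2·cubicOf = 2p₃ + 3p₂ − p₁² − 4p₁ − 6`. [cite: Iachello2015, (7.24)] -/
theorem two_mul_cubicOf (a b c : ℤ) :
    2 * cubicOf a b c = 2 * (a ^ 3 + b ^ 3 + c ^ 3) + 3 * (a ^ 2 + b ^ 2 + c ^ 2) - (a + b + c) ^ 2 - 4 * (a + b + c) - 6 := by
  unfold cubicOf; ring

/-- `cubicOf` is a symmetric function of the parameter (it depends only on the infinitesimal character). [cite: Iachello2015, (7.24)] -/
theorem cubicOf_swap₁₂ (a b c : ℤ) : cubicOf b a c = cubicOf a b c := by unfold cubicOf; ring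

/-- `cubicOf` is a symmetric function of the parameter. [cite: Iachello2015, (7.24)] -/
theorem cubicOf_swap₂₃ (a b c : ℤ) : cubicOf a c b = cubicOf a b c := by unfold cubicOf; ring

/-- Calibration target 1: the trivial representation (`λ = ρ = (1, 0, −1)`, every `E_{ij}` acts by `0`) has `C₃ = 0`. [cite: Molev2007, §7.1] -/
theorem cubicOf_trivial : cubicOf 1 0 (-1) = 0 := by unfold cubicOf; norm_num

/-- Calibration target 2: `det^m` (`λ = (m+1, m, m−1)`, `E_{ij} = m δ_{ij}`) has `C₃ = Σᵢ m³ = 3m³`. [cite: Molev2007, §7.1] -/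
theorem cubicOf_detPow (m : ℤ) : cubicOf (m + 1) m (m - 1) = 3 * m ^ 3 := by unfold cubicOf; ring

/-- Calibration target 3: the standard representation `ℂ³` (`λ = (2, 0, −1)`; `Σ_{i,j,k} E_{ij}E_{jk}E_{ki} = 9·1` in `M₃(ℂ)`) has `C₃ = 9`.
[cite: Molev2007, §7.1] -/
theorem cubicOf_standard : cubicOf 2 0 (-1) = 9 := by unfold cubicOf; norm_num

/-- The example of the module docstring: `(5, 1, −6)` and `(6, −1, −5)` share `(κ, e) = (60, 0)` (★ `casimirOf`, ★ `centralOf` currency: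
`p₂ − 2`, `p₁`) but are separated by the cubic value (`0 ≠ 180`). [cite: Iachello2015, (7.24)] -/
theorem cubicOf_separates_example :
    (5 : ℤ) ^ 2 + 1 ^ 2 + (-6) ^ 2 - 2 = 60 ∧ (6 : ℤ) ^ 2 + (-1) ^ 2 + (-5) ^ 2 - 2 = 60 ∧
      (5 : ℤ) + 1 + (-6) = 0 ∧ (6 : ℤ) + (-1) + (-5) = 0 ∧ cubicOf 5 1 (-6) = 0 ∧ cubicOf 6 (-1) (-5) = 180 := by
  unfold cubicOf; norm_num

end Summit.HodgeConjecture.HodgeConjecture.Cruxes.H413.K2E1bGKCohomologyU21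

end
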